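import Summits.BirchSwinnertonDyer.BirchSwinnertonDyer.Theorems.UniversalToricDescentRationalSplitIMCInclusionAtThreeClosedModuloPrint
import Summits.BirchSwinnertonDyer.BirchSwinnertonDyer.Theorems.UniversalToricDescentThinCombReflectionTransfer
import Summits.BirchSwinnertonDyer.BirchSwinnertonDyer.Theorems.UniversalToricDescentThinCombReflectedAvatar
import HarnessLib

/-!
# The rational wall `RationalSplitIMCInclusionAtThree` (stmt-BirchSwinnertonDyer-24207) CLOSED MODULO the v8.3 CANDIDATE inputs:
# clause (ii) of `stub_toricExistsSymmUpTo2` (analytic functional equation `φ_{A_τ} L₂ ∼ L₂`) DERIVED from a NORMALISED ♯♯-frame,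
# the complex functional equation in display currency, Jacquet's continuation on the cone, and the fibred character supply
# (certificate, `--supports stmt-BirchSwinnertonDyer-24207`; cell `pub/bsd-wall`, LEAD `cruxlead-24207` g32; LEAD-CENSUS-g32 §3 (β))

WHY THIS FILE. The registered line `ratwall_thin_comb` v8.2 asks in its first stub for a ♯♯-frame `L₂` of the two-variable toric
`3`-adic `L`-function (clause (i), `IsToricTwoVarLFunctionUpTo₂ C X Y …`) AND its symmetry up to a unit under the pinned frame involution
(clause (ii), `Associated (φ_{A_τ} L₂) L₂`), the latter being «complex FE + density + units — an argument without a printed statement».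
This gen landed the argument: `…ThinComb.ReflectionTransfer` (p766642: `φ_A L₂ = L₂` from partners with agreeing displays on a fibred
supply; normalised form `…_of_feRatio`) and `…ThinComb.ReflectedAvatar` (p766983: the partner `ψ† = (ψ∘c̄)⁻¹`, its avatar `r†(g) = r(τ g)`
through the pair, of the reflected type). This certificate ASSEMBLES them:

* **`toricExistsSymmUpTo2_of_normalised`** — the registered signature of `stub_toricExistsSymmUpTo2` VERBATIM, from four displayed inputs:
  (N) NORMALISED EXISTENCE: a ♯♯-frame with `Y = X · ι′⁻¹(κ)` for the functional-equation constant `κ = κ(N, d_K)` (the v8.3 candidate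
  stub 1′ — Hida 1988 Thm. 5.1b at `p = 3`, an adaptation; the constant is a parameter `κ : ℕ → ℤ → ℂ` of this file, expected
  `κ(N, d_K) = N·|d_K|/4`, LEAD-CENSUS-g32 §2); (FE) the COMPLEX FUNCTIONAL EQUATION of `L(f/K, ψ, s)` on the cone `Σ⁺` in display currency,
  `κ^a · V(ψ†; b, a) = κ^b · V(ψ; a, b)`, `ψ† = (ψ ∘ g)⁻¹` for the non-trivial `g ∈ Gal(K/ℚ)` (PRINT: Jacquet 1972 Thm. 19.14 + Tate's local
  constants; root number `+1` on the cone under the Heegner hypothesis); (P2) Jacquet's CONTINUATION of `L(f/K, ψ, s)` for unramified `ψ` of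
  every type `(a, −b)`, `a, b ≥ 1` (PRINT: Jacquet 1972 Cor. 19.15 — the tree's `jacquet1972_exists_entire_rankinSelbergHecke` is the ray
  `a = b`); (S) the FIBRED SUPPLY of interpolation characters through the pair in a `𝔭`-adapted frame (SUPPLY-GRID-utd-idea-g59 §2:
  Weil existence + class-group twist + the fibration; print + kernel).
* **`RationalSplitIMCInclusionAtThree_of_normalisedToric_of_fe_of_cont_of_supply_of_nekovar_of_ratCombDvd`** — the crux BY NAME from
  (N), (FE), (P2), (S), Nekovář's print fact (stub 2) and `stub_ratCombDvdUpTo2` (stub 3), through the v8.1 certificate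
  `RationalSplitIMCInclusionAtThree_of_toricExistsSymm_of_nekovar_of_ratCombDvd`.

HONEST SCOPE. A composition check for the planner (v8.3 is NOT registered; v8.2 stays the line of record): it shows that replacing clause (ii)
by the normalisation `Y = X·ι′⁻¹(κ)` keeps the crux closed modulo {(N), (FE), (P2), (S), Nekovář, K2-rat}. It proves none of the inputs;
nothing here is evidence that a normalised frame exists at the additive split `3`; BSD is not proved by any of this; 24207 / 20395 / 20186 OPEN.

References: [cite: Hida1988AIF, §5 Thm. 5.1b (doi:10.5802/aif.1141)] [cite: Jacquet1972, §19 Thm. 19.14, Cor. 19.15]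
[cite: CastellaWan2023, §2.4 Thm. 2.11 (arXiv:1607.02019)] [cite: HaoLoeffler2025, §4 Thm. 4.9 (arXiv:2405.12611)]
[cite: BuyukbodukLei2017, Def. 3.8 (arXiv:1707.00557)] [cite: Nekovar2006, Thm. 8.9.9, Prop. 9.6.6 (ii)] [cite: Gu2025FiniteSlopeUniversalRS, Conj. 2.15 (arXiv:2512.01184)]
-/

set_option linter.dupNamespace false
set_option autoImplicit false

noncomputable section

open scoped Classical MatrixGroups

namespace Summit.BirchSwinnertonDyer.BirchSwinnertonDyer.Theorems.UniversalToricDescentRatwallThinCombLine.V83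

open NumberField IsDedekindDomain Field
open Literature.NumberTheory.EllipticCurves Literature.NumberTheory.GaloisRepresentations
open Literature.NumberTheory.EllipticCurves.ModularForms
open Summit.BirchSwinnertonDyer.BirchSwinnertonDyer.Theorems.UniversalToricDescentThinComb

/-- **Clause (ii) DERIVED: the registered `stub_toricExistsSymmUpTo2` (v8.2, verbatim) from a NORMALISED ♯♯-frame (N), the complex functional
equation in display currency (FE), Jacquet's continuation on the cone (P2) and the fibred supply (S).** Proof: take `Y := X·ι′⁻¹(κ(N, d_K))`;
for a complex conjugation `c`, a lift `τ` and `A = A_τ`, every supply datum `(ψ, a, b, r, L)` has the partner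
`(ψ†, b, a, r†, L†)` of `…ReflectedAvatar.exists_reflected_partner` (`r†(γ_j) = r(τ γ_j)`), `L†` from (P2), displays related by (FE) for
`g = c̄ ≠ 1`; `…ReflectionTransfer.associated_frameSubst_of_toricUpTo₂_of_feRatio` concludes `φ_A L₂ ∼ L₂`.
[cite: HaoLoeffler2025, §4 Thm. 4.9 (arXiv:2405.12611)] [cite: Jacquet1972, §19 Thm. 19.14, Cor. 19.15] [cite: BuyukbodukLei2017, Def. 3.8 (arXiv:1707.00557)]
[cite: Hida1988AIF, §5 Thm. 5.1b] -/
theorem toricExistsSymmUpTo2_of_normalised (κ : ℕ → ℤ → ℂ) (hκ : ∀ N d, κ N d ≠ 0)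
    (hN :
        ∀ (W : WeierstrassCurve ℚ) [W.IsElliptic] [W.IsGloballyMinimal] (N : ℕ) [NeZero N] (K : Type) [Field K]
          [NumberField K] (Dt : Literature.NumberTheory.EllipticCurves.ModularForms.ModularParametrizationData W N),
        Summit.BirchSwinnertonDyer.Rank1Residual.Additive.ClassO6 W 3 → W.HasSurjectiveModNGaloisRep 3 →
        W.analyticRank = 1 → W.conductorNorm ℤ = N → IsImaginaryQuadratic K → SatisfiesHeegnerHypothesis N K →
        ∀ (κ' : ZpExtension K 3), κ'.IsAnticyclotomic → ∀ (γ : Field.absoluteGaloisGroup K) [Fact (κ'.IsTopGenerator γ)]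
          (𝔭 : HeightOneSpectrum (𝓞 K)), ((3 : ℕ) : 𝓞 K) ∈ 𝔭.asIdeal →
          𝔭.asIdeal.ramificationIdx (𝓞 ℚ) = 1 → 𝔭.asIdeal.inertiaDeg (𝓞 ℚ) = 1 →
        ∀ (𝔭' : HeightOneSpectrum (𝓞 K)), ((3 : ℕ) : 𝓞 K) ∈ 𝔭'.asIdeal → 𝔭' ≠ 𝔭 →
        ∀ (ι' : PadicAlgCl 3 ≃+* ℂ), Summit.BirchSwinnertonDyer.BirchSwinnertonDyer.Theorems.SchneiderFree.BranchInducesPrime 3 ι' 𝔭 →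
        ∀ (κ₁ κ₂ : ZpExtension K 3) (γ₁ γ₂ : Field.absoluteGaloisGroup K) (k : ℕ)
          [Fact (ZpExtension.IsTopGeneratorPair κ₁ κ₂ γ₁ γ₂)],
        (∀ v : HeightOneSpectrum (𝓞 K), v ≠ 𝔭 → ∀ 𝔓 ∈ v.primesAbove,
            𝔓.inertia (Field.absoluteGaloisGroup K) ≤ κ₁.kerSubgroup) →
        ZpExtension.pairKer κ₁ κ₂ ≤ κ'.kerSubgroup → γ₁ * γ⁻¹ ∈ κ'.kerSubgroup → γ₂ * (γ ^ (3 ^ k))⁻¹ ∈ κ'.kerSubgroup →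
        ∃ (ΩK' : ℂ) (C X : ℂ_[3]) (L₂ : PowerSeries (PowerSeries (unrIntegers 3))),
          ΩK' ≠ 0 ∧ C ≠ 0 ∧ X ≠ 0 ∧
          IsToricTwoVarLFunctionUpTo₂ C X (X * (((ι'.symm (κ N (NumberField.discr K)) : PadicAlgCl 3)) : ℂ_[3]))
            ι' 𝔭 𝔭' κ₁ κ₂ γ₁ γ₂ Dt.f ΩK' L₂)
    (hFE :
        ∀ (W : WeierstrassCurve ℚ) [W.IsElliptic] [W.IsGloballyMinimal] (N : ℕ) [NeZero N] (K : Type) [Field K]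
          [NumberField K] (Dt : Literature.NumberTheory.EllipticCurves.ModularForms.ModularParametrizationData W N),
        W.conductorNorm ℤ = N → IsImaginaryQuadratic K → SatisfiesHeegnerHypothesis N K →
        ∀ (𝔭 : HeightOneSpectrum (𝓞 K)), ((3 : ℕ) : 𝓞 K) ∈ 𝔭.asIdeal →
        ∀ (𝔭' : HeightOneSpectrum (𝓞 K)), ((3 : ℕ) : 𝓞 K) ∈ 𝔭'.asIdeal → 𝔭' ≠ 𝔭 →
        ∀ (g : K ≃ₐ[ℚ] K), g ≠ 1 → ∀ (ΩK' : ℂ) (ψ : HeckeCharacter K) (a b : ℕ), 1 ≤ a → 1 ≤ b →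
          ψ.HasInfinityType (fun _ ↦ (a : ℤ)) (fun _ ↦ -(b : ℤ)) →
          (∀ w : HeightOneSpectrum (𝓞 K), ψ.IsUnramifiedAt w) →
        ∀ (L L' : ℂ → ℂ), Differentiable ℂ L →
          (∀ s : ℂ, (a : ℝ) + 2 < s.re → L s = rankinSelbergEulerProductHecke Dt.f ψ s) →
          Differentiable ℂ L' →
          (∀ s : ℂ, (b : ℝ) + 2 < s.re → L' s = rankinSelbergEulerProductHecke Dt.f (HeckeCharacter.galConj g ψ)⁻¹ s) →
        κ N (NumberField.discr K) ^ a *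
            toricInterpolationValue 3 Dt.f 𝔭 𝔭' (HeckeCharacter.galConj g ψ)⁻¹ b a ΩK' (L' 1) =
          κ N (NumberField.discr K) ^ b * toricInterpolationValue 3 Dt.f 𝔭 𝔭' ψ a b ΩK' (L 1))
    (hP2 :
        ∀ (K : Type) [Field K] [NumberField K], IsImaginaryQuadratic K →
        ∀ {N : ℕ} [NeZero N] (W : WeierstrassCurve ℚ)
          (Dt : Literature.NumberTheory.EllipticCurves.ModularForms.ModularParametrizationData W N)
          (ψ : HeckeCharacter K) (a b : ℕ), 1 ≤ a → 1 ≤ b →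
          ψ.HasInfinityType (fun _ ↦ (a : ℤ)) (fun _ ↦ -(b : ℤ)) →
          (∀ w : HeightOneSpectrum (𝓞 K), ψ.IsUnramifiedAt w) →
        ∃ L : ℂ → ℂ, Differentiable ℂ L ∧
          ∀ s : ℂ, (a : ℝ) + 2 < s.re → L s = rankinSelbergEulerProductHecke Dt.f ψ s)
    (hS :
        ∀ (K : Type) [Field K] [NumberField K], IsImaginaryQuadratic K →
        ∀ {N : ℕ} [NeZero N] (W : WeierstrassCurve ℚ)
          (Dt : Literature.NumberTheory.EllipticCurves.ModularForms.ModularParametrizationData W N)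
          (𝔭 : HeightOneSpectrum (𝓞 K)), ((3 : ℕ) : 𝓞 K) ∈ 𝔭.asIdeal →
        ∀ (𝔭' : HeightOneSpectrum (𝓞 K)), ((3 : ℕ) : 𝓞 K) ∈ 𝔭'.asIdeal → 𝔭' ≠ 𝔭 →
        ∀ (ι' : PadicAlgCl 3 ≃+* ℂ) (κ₁ κ₂ : ZpExtension K 3) (γ₁ γ₂ : Field.absoluteGaloisGroup K),
          ZpExtension.IsTopGeneratorPair κ₁ κ₂ γ₁ γ₂ →
        (∀ v : HeightOneSpectrum (𝓞 K), v ≠ 𝔭 → ∀ 𝔓 ∈ v.primesAbove,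
            𝔓.inertia (Field.absoluteGaloisGroup K) ≤ κ₁.kerSubgroup) →
        ∃ ϖ : ℂ_[3], ϖ ≠ 0 ∧ ‖ϖ‖ < 1 ∧ ∃ D₂ : Set ℂ_[3], D₂.Infinite ∧ (∀ y ∈ D₂, ‖y‖ ≤ ‖ϖ‖) ∧
          ∀ y ∈ D₂, {x : ℂ_[3] | ‖x‖ ≤ ‖ϖ‖ ∧
            ∃ (ψ : HeckeCharacter K) (a b : ℕ) (r : FramedGaloisRep K (PadicAlgCl 3) 1) (L : ℂ → ℂ),
              1 ≤ a ∧ 1 ≤ b ∧ ψ.HasInfinityType (fun _ ↦ (a : ℤ)) (fun _ ↦ -(b : ℤ)) ∧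
              (∀ w : HeightOneSpectrum (𝓞 K), ψ.IsUnramifiedAt w) ∧ IsPAdicAvatarOf ι' ψ r ∧
              FactorsThroughPair κ₁ κ₂ r ∧ Differentiable ℂ L ∧
              (∀ s : ℂ, (a : ℝ) + 2 < s.re → L s = rankinSelbergEulerProductHecke Dt.f ψ s) ∧
              avatarValueAt r γ₁ - 1 = x ∧ avatarValueAt r γ₂ - 1 = y}.Infinite) :
    ∀ (W : WeierstrassCurve ℚ) [W.IsElliptic] [W.IsGloballyMinimal] (N : ℕ) [NeZero N] (K : Type) [Field K]
      [NumberField K] (Dt : Literature.NumberTheory.EllipticCurves.ModularForms.ModularParametrizationData W N),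
    Summit.BirchSwinnertonDyer.Rank1Residual.Additive.ClassO6 W 3 → W.HasSurjectiveModNGaloisRep 3 →
    W.analyticRank = 1 → W.conductorNorm ℤ = N → IsImaginaryQuadratic K → SatisfiesHeegnerHypothesis N K →
    ∀ (κ' : ZpExtension K 3), κ'.IsAnticyclotomic → ∀ (γ : Field.absoluteGaloisGroup K) [Fact (κ'.IsTopGenerator γ)]
      (𝔭 : HeightOneSpectrum (𝓞 K)), ((3 : ℕ) : 𝓞 K) ∈ 𝔭.asIdeal →
      𝔭.asIdeal.ramificationIdx (𝓞 ℚ) = 1 → 𝔭.asIdeal.inertiaDeg (𝓞 ℚ) = 1 →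
    ∀ (𝔭' : HeightOneSpectrum (𝓞 K)), ((3 : ℕ) : 𝓞 K) ∈ 𝔭'.asIdeal → 𝔭' ≠ 𝔭 →
    ∀ (ι' : PadicAlgCl 3 ≃+* ℂ), Summit.BirchSwinnertonDyer.BirchSwinnertonDyer.Theorems.SchneiderFree.BranchInducesPrime 3 ι' 𝔭 →
    ∀ (κ₁ κ₂ : ZpExtension K 3) (γ₁ γ₂ : Field.absoluteGaloisGroup K) (k : ℕ)
      [Fact (ZpExtension.IsTopGeneratorPair κ₁ κ₂ γ₁ γ₂)],
    (∀ v : HeightOneSpectrum (𝓞 K), v ≠ 𝔭 → ∀ 𝔓 ∈ v.primesAbove,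
        𝔓.inertia (Field.absoluteGaloisGroup K) ≤ κ₁.kerSubgroup) →
    ZpExtension.pairKer κ₁ κ₂ ≤ κ'.kerSubgroup → γ₁ * γ⁻¹ ∈ κ'.kerSubgroup → γ₂ * (γ ^ (3 ^ k))⁻¹ ∈ κ'.kerSubgroup →
    ∃ (ΩK' : ℂ) (C X Y : ℂ_[3]) (L₂ : PowerSeries (PowerSeries (unrIntegers 3))),
      ΩK' ≠ 0 ∧ C ≠ 0 ∧ X ≠ 0 ∧ Y ≠ 0 ∧
      IsToricTwoVarLFunctionUpTo₂ C X Y ι' 𝔭 𝔭' κ₁ κ₂ γ₁ γ₂ Dt.f ΩK' L₂ ∧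
      ∀ (c : Field.absoluteGaloisGroup ℚ), c ∉ Set.range (absGaloisRestrict ℚ K) →
      ∀ (τ : Field.absoluteGaloisGroup K → Field.absoluteGaloisGroup K),
        (∀ σ, absGaloisRestrict ℚ K (τ σ) = c * (absGaloisRestrict ℚ K σ)⁻¹ * c⁻¹) →
      ∀ (A : GL (Fin 2) ℤ_[3]), (A : Matrix (Fin 2) (Fin 2) ℤ_[3]) = IwasawaAlgebra₂.frameMatrixOf κ₁ κ₂ γ₁ γ₂ τ →
        letI : Algebra ℤ_[3] (unrIntegers 3) := (Summit.BirchSwinnertonDyer.Rank1Residual.X11b.Halves.toUnr 3).toAlgebra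
        Associated (IwasawaAlgebra₂.frameSubst (unrIntegers 3) A L₂) L₂ := by
  intro W _ _ N _ K _ _ Dt hO6 hsurj hrk hN' hK hH κ' hκ' γ hγ 𝔭 h3 hram hdeg 𝔭' h3' hne ι' hι κ₁ κ₂ γ₁ γ₂ k hpair hur₁ hker hγ₁ hγ₂
  obtain ⟨ΩK', C, X, L₂, hΩK', hC, hX, hL₂⟩ :=
    hN W N K Dt hO6 hsurj hrk hN' hK hH κ' hκ' γ 𝔭 h3 hram hdeg 𝔭' h3' hne ι' hι κ₁ κ₂ γ₁ γ₂ k hur₁ hker hγ₁ hγ₂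
  set κc : ℂ := κ N (NumberField.discr K) with hκc
  have hκc0 : κc ≠ 0 := hκ N _
  set Y : ℂ_[3] := X * (((ι'.symm κc : PadicAlgCl 3)) : ℂ_[3]) with hYdef
  have hY0 : Y ≠ 0 := by
    refine mul_ne_zero hX ?_
    rw [PadicComplex.coe_eq]
    exact (map_ne_zero_iff _ (algebraMap (PadicAlgCl 3) ℂ_[3]).injective).mpr ((map_ne_zero_iff _ ι'.symm.injective).mpr hκc0)
  refine ⟨ΩK', C, X, Y, L₂, hΩK', hC, hX, hY0, hL₂, ?_⟩
  intro c hc τ hτ A hA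
  haveI : IsGalois ℚ K := Literature.FieldTheory.Galois.isGalois_of_finrank_eq_two hK.1
  -- the non-trivial element `c̄` of `Gal(K/ℚ)`
  have hg : absGaloisQuot ℚ K c ≠ 1 := fun h ↦ hc ((absGaloisQuot_eq_one_iff ℚ K c).mp h)
  -- the fibred supply in this 𝔭-adapted frame
  obtain ⟨ϖ, hϖ0, hϖ, D₂, hD₂, hD₂ϖ, hfib⟩ := hS K hK W Dt 𝔭 h3 𝔭' h3' hne ι' κ₁ κ₂ γ₁ γ₂ hpair.out hur₁
  refine ReflectionTransfer.associated_frameSubst_of_toricUpTo₂_of_feRatio hpair.out τ A hA hL₂ (κ := κc) rfl hϖ0 hϖ hD₂ hD₂ϖ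
    fun y hy ↦ (hfib y hy).mono fun x hx ↦ ⟨hx.1, ?_⟩
  obtain ⟨ψ, a, b, r, L, ha, hb, hinf, hunr, hr, hrκ, hLd, hLe, hx1, hy1⟩ := hx.2
  -- the reflected partner `(ψ†, r†)` and its continuation
  obtain ⟨ψ', r', hψ', hinf', hunr', hr', hrκ', hval⟩ :=
    ReflectedAvatar.exists_reflected_partner hK ι' hpair.out hc hτ hinf hunr hr hrκ
  obtain ⟨L', hL'd, hL'e⟩ := hP2 K hK W Dt ψ' b a hb ha hinf' hunr'
  have hfe := hFE W N K Dt hN' hK hH 𝔭 h3 𝔭' h3' hne (absGaloisQuot ℚ K c) hg ΩK' ψ a b ha hb hinf hunr L L' hLd hLe hL'd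
    (by rw [← hψ']; exact hL'e)
  rw [← hψ'] at hfe
  exact ⟨ψ, ψ', a, b, r, r', L, L', ha, hb, hinf, hunr, hr, hrκ, hLd, hLe, hinf', hunr', hr', hrκ', hL'd, hL'e, hval γ₁, hval γ₂,
    hfe, hx1, hy1⟩

/-- **THE CRUX BY NAME from the v8.3 candidate inputs**: normalised existence (N), the complex functional equation (FE), Jacquet's
continuation on the cone (P2), the fibred supply (S), Nekovář's two-variable algebraic functional equation (print fact, stub 2) and the
rational thin-comb divisibility (stub 3, OPEN research) — through the v8.1 certificate
`RationalSplitIMCInclusionAtThree_of_toricExistsSymm_of_nekovar_of_ratCombDvd` with stub 1 supplied by `toricExistsSymmUpTo2_of_normalised`.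
[cite: Nekovar2006, Thm. 8.9.9, Prop. 9.6.6 (ii)] [cite: Gu2025FiniteSlopeUniversalRS, Conj. 2.15 (arXiv:2512.01184)] [cite: Hida1988AIF, §5 Thm. 5.1b]
[cite: Jacquet1972, §19 Thm. 19.14, Cor. 19.15] -/
theorem RationalSplitIMCInclusionAtThree_of_normalisedToric_of_fe_of_cont_of_supply_of_nekovar_of_ratCombDvd
    (κ : ℕ → ℤ → ℂ) (hκ : ∀ N d, κ N d ≠ 0)
    (hN :
        ∀ (W : WeierstrassCurve ℚ) [W.IsElliptic] [W.IsGloballyMinimal] (N : ℕ) [NeZero N] (K : Type) [Field K]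
          [NumberField K] (Dt : Literature.NumberTheory.EllipticCurves.ModularForms.ModularParametrizationData W N),
        Summit.BirchSwinnertonDyer.Rank1Residual.Additive.ClassO6 W 3 → W.HasSurjectiveModNGaloisRep 3 →
        W.analyticRank = 1 → W.conductorNorm ℤ = N → IsImaginaryQuadratic K → SatisfiesHeegnerHypothesis N K →
        ∀ (κ' : ZpExtension K 3), κ'.IsAnticyclotomic → ∀ (γ : Field.absoluteGaloisGroup K) [Fact (κ'.IsTopGenerator γ)]
          (𝔭 : HeightOneSpectrum (𝓞 K)), ((3 : ℕ) : 𝓞 K) ∈ 𝔭.asIdeal →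
          𝔭.asIdeal.ramificationIdx (𝓞 ℚ) = 1 → 𝔭.asIdeal.inertiaDeg (𝓞 ℚ) = 1 →
        ∀ (𝔭' : HeightOneSpectrum (𝓞 K)), ((3 : ℕ) : 𝓞 K) ∈ 𝔭'.asIdeal → 𝔭' ≠ 𝔭 →
        ∀ (ι' : PadicAlgCl 3 ≃+* ℂ), Summit.BirchSwinnertonDyer.BirchSwinnertonDyer.Theorems.SchneiderFree.BranchInducesPrime 3 ι' 𝔭 →
        ∀ (κ₁ κ₂ : ZpExtension K 3) (γ₁ γ₂ : Field.absoluteGaloisGroup K) (k : ℕ)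
          [Fact (ZpExtension.IsTopGeneratorPair κ₁ κ₂ γ₁ γ₂)],
        (∀ v : HeightOneSpectrum (𝓞 K), v ≠ 𝔭 → ∀ 𝔓 ∈ v.primesAbove,
            𝔓.inertia (Field.absoluteGaloisGroup K) ≤ κ₁.kerSubgroup) →
        ZpExtension.pairKer κ₁ κ₂ ≤ κ'.kerSubgroup → γ₁ * γ⁻¹ ∈ κ'.kerSubgroup → γ₂ * (γ ^ (3 ^ k))⁻¹ ∈ κ'.kerSubgroup →
        ∃ (ΩK' : ℂ) (C X : ℂ_[3]) (L₂ : PowerSeries (PowerSeries (unrIntegers 3))),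
          ΩK' ≠ 0 ∧ C ≠ 0 ∧ X ≠ 0 ∧
          IsToricTwoVarLFunctionUpTo₂ C X (X * (((ι'.symm (κ N (NumberField.discr K)) : PadicAlgCl 3)) : ℂ_[3]))
            ι' 𝔭 𝔭' κ₁ κ₂ γ₁ γ₂ Dt.f ΩK' L₂)
    (hFE :
        ∀ (W : WeierstrassCurve ℚ) [W.IsElliptic] [W.IsGloballyMinimal] (N : ℕ) [NeZero N] (K : Type) [Field K]
          [NumberField K] (Dt : Literature.NumberTheory.EllipticCurves.ModularForms.ModularParametrizationData W N),
        W.conductorNorm ℤ = N → IsImaginaryQuadratic K → SatisfiesHeegnerHypothesis N K →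
        ∀ (𝔭 : HeightOneSpectrum (𝓞 K)), ((3 : ℕ) : 𝓞 K) ∈ 𝔭.asIdeal →
        ∀ (𝔭' : HeightOneSpectrum (𝓞 K)), ((3 : ℕ) : 𝓞 K) ∈ 𝔭'.asIdeal → 𝔭' ≠ 𝔭 →
        ∀ (g : K ≃ₐ[ℚ] K), g ≠ 1 → ∀ (ΩK' : ℂ) (ψ : HeckeCharacter K) (a b : ℕ), 1 ≤ a → 1 ≤ b →
          ψ.HasInfinityType (fun _ ↦ (a : ℤ)) (fun _ ↦ -(b : ℤ)) →
          (∀ w : HeightOneSpectrum (𝓞 K), ψ.IsUnramifiedAt w) →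
        ∀ (L L' : ℂ → ℂ), Differentiable ℂ L →
          (∀ s : ℂ, (a : ℝ) + 2 < s.re → L s = rankinSelbergEulerProductHecke Dt.f ψ s) →
          Differentiable ℂ L' →
          (∀ s : ℂ, (b : ℝ) + 2 < s.re → L' s = rankinSelbergEulerProductHecke Dt.f (HeckeCharacter.galConj g ψ)⁻¹ s) →
        κ N (NumberField.discr K) ^ a *
            toricInterpolationValue 3 Dt.f 𝔭 𝔭' (HeckeCharacter.galConj g ψ)⁻¹ b a ΩK' (L' 1) =
          κ N (NumberField.discr K) ^ b * toricInterpolationValue 3 Dt.f 𝔭 𝔭' ψ a b ΩK' (L 1))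
    (hP2 :
        ∀ (K : Type) [Field K] [NumberField K], IsImaginaryQuadratic K →
        ∀ {N : ℕ} [NeZero N] (W : WeierstrassCurve ℚ)
          (Dt : Literature.NumberTheory.EllipticCurves.ModularForms.ModularParametrizationData W N)
          (ψ : HeckeCharacter K) (a b : ℕ), 1 ≤ a → 1 ≤ b →
          ψ.HasInfinityType (fun _ ↦ (a : ℤ)) (fun _ ↦ -(b : ℤ)) →
          (∀ w : HeightOneSpectrum (𝓞 K), ψ.IsUnramifiedAt w) →
        ∃ L : ℂ → ℂ, Differentiable ℂ L ∧
          ∀ s : ℂ, (a : ℝ) + 2 < s.re → L s = rankinSelbergEulerProductHecke Dt.f ψ s)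
    (hS :
        ∀ (K : Type) [Field K] [NumberField K], IsImaginaryQuadratic K →
        ∀ {N : ℕ} [NeZero N] (W : WeierstrassCurve ℚ)
          (Dt : Literature.NumberTheory.EllipticCurves.ModularForms.ModularParametrizationData W N)
          (𝔭 : HeightOneSpectrum (𝓞 K)), ((3 : ℕ) : 𝓞 K) ∈ 𝔭.asIdeal →
        ∀ (𝔭' : HeightOneSpectrum (𝓞 K)), ((3 : ℕ) : 𝓞 K) ∈ 𝔭'.asIdeal → 𝔭' ≠ 𝔭 →
        ∀ (ι' : PadicAlgCl 3 ≃+* ℂ) (κ₁ κ₂ : ZpExtension K 3) (γ₁ γ₂ : Field.absoluteGaloisGroup K),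
          ZpExtension.IsTopGeneratorPair κ₁ κ₂ γ₁ γ₂ →
        (∀ v : HeightOneSpectrum (𝓞 K), v ≠ 𝔭 → ∀ 𝔓 ∈ v.primesAbove,
            𝔓.inertia (Field.absoluteGaloisGroup K) ≤ κ₁.kerSubgroup) →
        ∃ ϖ : ℂ_[3], ϖ ≠ 0 ∧ ‖ϖ‖ < 1 ∧ ∃ D₂ : Set ℂ_[3], D₂.Infinite ∧ (∀ y ∈ D₂, ‖y‖ ≤ ‖ϖ‖) ∧
          ∀ y ∈ D₂, {x : ℂ_[3] | ‖x‖ ≤ ‖ϖ‖ ∧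
            ∃ (ψ : HeckeCharacter K) (a b : ℕ) (r : FramedGaloisRep K (PadicAlgCl 3) 1) (L : ℂ → ℂ),
              1 ≤ a ∧ 1 ≤ b ∧ ψ.HasInfinityType (fun _ ↦ (a : ℤ)) (fun _ ↦ -(b : ℤ)) ∧
              (∀ w : HeightOneSpectrum (𝓞 K), ψ.IsUnramifiedAt w) ∧ IsPAdicAvatarOf ι' ψ r ∧
              FactorsThroughPair κ₁ κ₂ r ∧ Differentiable ℂ L ∧
              (∀ s : ℂ, (a : ℝ) + 2 < s.re → L s = rankinSelbergEulerProductHecke Dt.f ψ s) ∧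
              avatarValueAt r γ₁ - 1 = x ∧ avatarValueAt r γ₂ - 1 = y}.Infinite)
    (hNek : Literature.NumberTheory.EllipticCurves.nekovar2006_xGr₂_isTorsion_iff_and_charIdeal_eq_map_inv)
    (hK2 :
        ∀ (W : WeierstrassCurve ℚ) [W.IsElliptic] [W.IsGloballyMinimal] (N : ℕ) [NeZero N] (K : Type) [Field K]
          [NumberField K] (Dt : Literature.NumberTheory.EllipticCurves.ModularForms.ModularParametrizationData W N),
        Summit.BirchSwinnertonDyer.Rank1Residual.Additive.ClassO6 W 3 → W.HasSurjectiveModNGaloisRep 3 →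
        W.analyticRank = 1 → W.conductorNorm ℤ = N → IsImaginaryQuadratic K → SatisfiesHeegnerHypothesis N K →
        ∀ (𝔭 : HeightOneSpectrum (𝓞 K)), ((3 : ℕ) : 𝓞 K) ∈ 𝔭.asIdeal →
          𝔭.asIdeal.ramificationIdx (𝓞 ℚ) = 1 → 𝔭.asIdeal.inertiaDeg (𝓞 ℚ) = 1 →
        ∀ (𝔭' : HeightOneSpectrum (𝓞 K)), ((3 : ℕ) : 𝓞 K) ∈ 𝔭'.asIdeal → 𝔭' ≠ 𝔭 →
        ∀ (ι' : PadicAlgCl 3 ≃+* ℂ), Summit.BirchSwinnertonDyer.BirchSwinnertonDyer.Theorems.SchneiderFree.BranchInducesPrime 3 ι' 𝔭 →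
        ∀ (κ₁ κ₂ : ZpExtension K 3) (γ₁ γ₂ : Field.absoluteGaloisGroup K)
          [Fact (ZpExtension.IsTopGeneratorPair κ₁ κ₂ γ₁ γ₂)],
        (∀ v : HeightOneSpectrum (𝓞 K), v ≠ 𝔭 → ∀ 𝔓 ∈ v.primesAbove,
            𝔓.inertia (Field.absoluteGaloisGroup K) ≤ κ₁.kerSubgroup) →
        Module.Finite (IwasawaAlgebra₂ 3) ((W.baseChange K).XGr₂ 3 κ₁ κ₂ 𝔭' γ₁ γ₂) →
        Module.IsTorsion (IwasawaAlgebra₂ 3) ((W.baseChange K).XGr₂ 3 κ₁ κ₂ 𝔭' γ₁ γ₂) →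
        ∀ (g : IwasawaAlgebra₂ 3),
          Literature.NumberTheory.EllipticCurves.Module.charIdeal (IwasawaAlgebra₂ 3)
            ((W.baseChange K).XGr₂ 3 κ₁ κ₂ 𝔭' γ₁ γ₂) = Ideal.span {g} →
        ∀ (ΩK' : ℂ) (C X Y : ℂ_[3]) (L₂ : PowerSeries (PowerSeries (unrIntegers 3))), ΩK' ≠ 0 → C ≠ 0 → X ≠ 0 → Y ≠ 0 →
          IsToricTwoVarLFunctionUpTo₂ C X Y ι' 𝔭 𝔭' κ₁ κ₂ γ₁ γ₂ Dt.f ΩK' L₂ →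
        ThinCombDvdRat (unrIntegers 3) 3
          (PowerSeries.map (PowerSeries.map (Summit.BirchSwinnertonDyer.Rank1Residual.X11b.Halves.toUnr 3)) g) L₂) :
    Summit.BirchSwinnertonDyer.BirchSwinnertonDyer.Theses.UniversalToricDescent.RationalSplitIMCInclusionAtThree :=
  RationalSplitIMCInclusionAtThree_of_toricExistsSymm_of_nekovar_of_ratCombDvd
    (toricExistsSymmUpTo2_of_normalised κ hκ hN hFE hP2 hS) hNek hK2

end Summit.BirchSwinnertonDyer.BirchSwinnertonDyer.Theorems.UniversalToricDescentRatwallThinCombLine.V83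

end
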